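import Literature.NumberTheory.DiophantineGeometry.SymmetricGroupReps
import Mathlib.GroupTheory.Perm.Cycle.Type
import HarnessLib

/-!
# Discharged fact: the character formula for Kronecker coefficients (Fulton–Harris, Exercise 4.51(a))

`Literature.NumberTheory.DiophantineGeometry.SymmetricGroupReps` records as a named fact
(`Literature.CplxAlg.kroneckerCoeff_eq_sum_spechtCharacter : Prop`) that over a field `k` of
characteristic zero the Kronecker coefficient
`g(λ, μ, ν) = dim_k Hom_{S_d}(S^λ ⊗ S^μ, S^ν)` (`Literature.NumberTheory.DiophantineGeometry.kroneckerCoeff`) of three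
partitions `λ, μ, ν ⊢ d` satisfies
`d! · g(λ, μ, ν) = ∑_{σ ∈ S_d} χ^λ(σ) χ^μ(σ) χ^ν(σ)`,
where `χ^μ` is the character of the Specht module `S^μ` (`Literature.NumberTheory.DiophantineGeometry.spechtCharacter`). This is
W. Fulton, J. Harris, *Representation Theory. A First Course*, Exercise 4.51(a):
`C_{λμν} = ∑_𝐢 z(𝐢)⁻¹ ω_λ(𝐢) ω_μ(𝐢) ω_ν(𝐢)`, the sum over the conjugacy classes `C_𝐢` of `𝔖_d`
(of cardinality `d!/z(𝐢)`) with `ω_λ(𝐢) = χ_λ(C_𝐢)`, i.e. `C_{λμν} = (1/d!) ∑_{g ∈ 𝔖_d}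
χ_λ(g) χ_μ(g) χ_ν(g)`, obtained from Corollary 2.16 (the multiplicity of an irreducible `V_i`
in `V` is `(χ_V, χ_{V_i})`, with `(α, β) = |G|⁻¹ ∑_g \overline{α(g)} β(g)`, (2.11)) and
Proposition 2.1 (`χ_{V ⊗ W} = χ_V χ_W`). This file proves it
(`Literature.NumberTheory.DiophantineGeometry.kroneckerCoeff_eq_sum_spechtCharacter_holds`), for every field of
characteristic zero (no algebraic closure is needed, exactly as the fact is stated).

## Proof

Following Fulton–Harris §2.2: for finite-dimensional representations `V, W` of a finite group
`G` over a field `k` in which `|G|` is invertible,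
`dim_k Hom_G(V, W) = |G|⁻¹ ∑_{g ∈ G} χ_W(g) χ_V(g⁻¹)` — formula (2.9)
(`dim V^G = |G|⁻¹ ∑_g χ_V(g)`, the trace of the averaging projector of Proposition 2.8) applied
to the representation `Hom(V, W) = V* ⊗ W`, whose invariants are the `G`-homomorphisms; this is
Mathlib's `Representation.card_inv_mul_sum_char_mul_char_eq_finrank`. We apply it to
`V = S^λ ⊗ S^μ`, `W = S^ν` (the Specht modules are finite-dimensional, being subspaces of
`k[S_d]`), expand `χ_{S^λ ⊗ S^μ} = χ^λ χ^μ` (Proposition 2.1; Mathlib's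
`Representation.char_tensor`), use `|S_d| = d!`, and finally `χ(g⁻¹) = χ(g)` for every
character of `S_d` (`Literature.NumberTheory.DiophantineGeometry.spechtCharacter_inv`: `g⁻¹` has the cycle type of `g`, hence is
conjugate to `g`, Mathlib's `Equiv.Perm.isConj_iff_cycleType_eq`, and characters are class
functions, `Representation.char_conj`), then clear the denominator `d!`.

## References

* W. Fulton, J. Harris, *Representation Theory. A First Course*, GTM 129, Springer (1991),
  doi:10.1007/978-1-4612-0979-9: §2.1 Proposition 2.1; §2.2 Proposition 2.8, (2.9)–(2.11),
  Corollary 2.16; §4.3 Exercise 4.51(a). [FultonHarrisGTM129]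
-/

noncomputable section

open scoped BigOperators TensorProduct

namespace Literature.NumberTheory.DiophantineGeometry

section CplxAlg

variable (k : Type*) [Field k] {d : ℕ}

/-- Every permutation is conjugate in `S_d` to its inverse (both have the same cycle type), so
every character of `S_d` takes the same value at `σ⁻¹` and at `σ`; in particular
`χ^μ(σ⁻¹) = χ^μ(σ)` for the Specht characters (Fulton–Harris §2.1, characters are class
functions, with §4.1; James, LNM 682, §6). From Mathlib's `Equiv.Perm.isConj_iff_cycleType_eq`,
`Equiv.Perm.cycleType_inv` and `Representation.char_conj`. [folklore] -/
theorem spechtCharacter_inv (μ : Nat.Partition d) (σ : Equiv.Perm (Fin d)) :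
    spechtCharacter k μ σ⁻¹ = spechtCharacter k μ σ := by
  have h : IsConj σ σ⁻¹ :=
    Equiv.Perm.isConj_iff_cycleType_eq.mpr (Equiv.Perm.cycleType_inv σ).symm
  obtain ⟨c, hc⟩ := isConj_iff.mp h
  rw [← hc]
  exact (spechtRep k μ).char_conj σ c

/-- **Discharge** of the named fact `kroneckerCoeff_eq_sum_spechtCharacter`: over any field of
characteristic zero, `d! · g(λ, μ, ν) = ∑_{σ ∈ S_d} χ^λ(σ) χ^μ(σ) χ^ν(σ)` for all partitions
`λ, μ, ν ⊢ d` (Fulton–Harris, Exercise 4.51(a): `C_{λμν} = ∑_𝐢 z(𝐢)⁻¹ ω_λ(𝐢) ω_μ(𝐢) ω_ν(𝐢)`,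
via Corollary 2.16, formula (2.9) for `Hom(V, W)` and Proposition 2.1; see the module docstring
for the proof). [cite: FultonHarrisGTM129, Exercise 4.51(a) with Corollary 2.16, (2.9)–(2.11) and Proposition 2.1] -/
theorem kroneckerCoeff_eq_sum_spechtCharacter_holds :
    kroneckerCoeff_eq_sum_spechtCharacter k (d := d) := by
  intro _ lam μ ν
  have hcard : Nat.card (Equiv.Perm (Fin d)) = d.factorial := by
    rw [Nat.card_eq_fintype_card, Fintype.card_perm, Fintype.card_fin]
  have hne : (Nat.card (Equiv.Perm (Fin d)) : k) ≠ 0 := by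
    rw [hcard]; exact_mod_cast d.factorial_ne_zero
  haveI : Invertible (Nat.card (Equiv.Perm (Fin d)) : k) := invertibleOfNonzero hne
  -- `|G|⁻¹ ∑_g χ_ν(g) χ_{λ⊗μ}(g⁻¹) = dim Hom_G(S^λ ⊗ S^μ, S^ν)` (Fulton–Harris (2.9), Cor. 2.16).
  have key := Representation.card_inv_mul_sum_char_mul_char_eq_finrank
    (V := ↥(spechtIdeal k lam) ⊗[k] ↥(spechtIdeal k μ))
    ((spechtRep k lam).tprod (spechtRep k μ)) (spechtRep k ν)
  -- `χ_{λ⊗μ} = χ_λ χ_μ` (Fulton–Harris, Proposition 2.1).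
  rw [Representation.char_tensor] at key
  have key' : ((kroneckerCoeff k lam μ ν : ℕ) : k) =
      (Nat.card (Equiv.Perm (Fin d)) : k)⁻¹ * ∑ g : Equiv.Perm (Fin d),
        spechtCharacter k ν g * (spechtCharacter k lam g⁻¹ * spechtCharacter k μ g⁻¹) := by
    rw [kroneckerCoeff, ← key]; rfl
  -- `χ(g⁻¹) = χ(g)` in `S_d`; then clear the denominator `|S_d| = d!`.
  simp only [spechtCharacter_inv] at key'
  rw [Nat.cast_mul, key', ← hcard, ← mul_assoc, mul_inv_cancel₀ hne, one_mul]
  refine Finset.sum_congr rfl fun g _ ↦ ?_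
  ring

end CplxAlg

end Literature.NumberTheory.DiophantineGeometry
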